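import Literature.AnabelianGeometry.AbsoluteAnabelian.CharacteristicOpenSubgroups
import Literature.AnabelianGeometry.SemiGraphs.SplittingCriterion
import Literature.AnabelianGeometry.SemiGraphs.BObjDegree
import Literature.AnabelianGeometry.SemiGraphs.FreeCoverings
import Literature.AnabelianGeometry.SemiGraphs.PullbackFunctor
import Literature.AnabelianGeometry.SemiGraphs.Coverticial
import Literature.AnabelianGeometry.SemiGraphs.MorphismsOver

/-!
# Proof of [IUTchI] Remark 2.5.3 (i) (T4): strictly coherent, countable, connected ⇒ Galois-countable

Mochizuki, *Inter-universal Teichmüller theory I*, Rmk. 2.5.3 (i), kurims manuscript pp. 52–53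
[cite: Mochizuki2012, IUTchI Rem. 2.5.3(i)(T4) p.53]: "(T4) One verifies immediately that every strictly
coherent, countable semi-graph of anabelioids is Galois-countable" — with the two repairs of the audit
finding L3t7-F1 built into the statement (`Coverticial.lean` rev. 2, `GaloisCountableGraphs.lean`
rev.): the cofinal countable family of finite étale coverings consists of honest (non-initial)
coverings, and `𝒢` is connected.

This file DISCHARGES `SemiGraphOfAnabelioids.isGaloisCountable_of_isStrictlyCoherent`.  The
verification (which is not quite "immediate"): for each `i`, strict coherence (`≤ N` topological
generators at every component) yields characteristic open subgroups `U_{c,i} ⊆ Π_c` contained in every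
open subgroup of index `≤ i`, of index bounded by `M_i = (i!)^((i!)^N)` uniformly in `c`
(`CharacteristicOpenSubgroups.lean`); quasi-coherence yields an approximator `φ_i : 𝒢 → 𝒢'_i` splitting
the collection `{U_{c,i}}`; over the bounded-order `𝒢'_i` there is a covering `A'_i` with FREE
constituents (`FreeCoverings.lean`), and `A_i := φ_i^* A'_i` (`PullbackFunctor.lean`).  Given a finite
étale covering `B` of (constant, `𝒢` being connected: `BObjDegree.lean`) degree `d`, every stabiliser
of a point of a constituent of `A_d` lies in `Ker(Π_c → Π'_c) ⊆ U_{c,d} ⊆ Ker(Π_c → 𝔖(B_c))`, so `B`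
splits over every component of every constituent of `A_d` (`SplittingCriterion.lean`).  A vertex-free
connected `𝒢` (a single edge) is treated directly with the quotient covering `Π_e/U_{e,i}`; that
every edge of a connected `𝒢` with a vertex abuts is `SemiGraph.exists_abuts_of_isConnected`
(`MorphismsOver.lean`).  Proof-only (no definitions).
-/

namespace Literature.AnabelianGeometry.SemiGraphs

open CategoryTheory CategoryTheory.Limits CategoryTheory.PreGaloisCategory
open Literature.AnabelianGeometry.Anabelioids
open Literature.AnabelianGeometry.AbsoluteAnabelian
open scoped Nat

universe v₁ u₁ u

namespace SemiGraphOfAnabelioids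

/-- Objects from `π₁`-sets in an arbitrary universe (transport of `exists_obj_of_aut_action` along a
numbering of the finite set). [cite: MochizukiGeoAn2004, §1.1 p.10] -/
theorem exists_obj_of_aut_action' {C : Type u₁} [Category.{v₁} C] [GaloisCategory C]
    (F : C ⥤ FintypeCat.{v₁}) [FiberFunctor F] (Y : Type*) [Finite Y] [MulAction (Aut F) Y]
    (hY : ∀ y : Y, IsOpen (MulAction.stabilizer (Aut F) y : Set (Aut F))) :
    ∃ (X : C) (e : F.obj X ≃ Y), ∀ (σ : Aut F) (x : F.obj X), e (σ • x) = σ • e x := by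
  classical
  obtain ⟨m, ⟨η⟩⟩ := Finite.exists_equiv_fin Y
  let Y' : Type v₁ := ULift.{v₁} (Fin m)
  letI : MulAction (Aut F) Y' :=
    { smul := fun σ y => ⟨η (σ • η.symm y.down)⟩
      one_smul := fun y => by
        apply ULift.ext
        change η ((1 : Aut F) • η.symm y.down) = y.down
        rw [one_smul, Equiv.apply_symm_apply]
      mul_smul := fun σ τ y => by
        apply ULift.ext
        change η ((σ * τ) • η.symm y.down) = η (σ • η.symm (η (τ • η.symm y.down)))
        rw [Equiv.symm_apply_apply, mul_smul] }
  have hY' : ∀ y : Y', IsOpen (MulAction.stabilizer (Aut F) y : Set (Aut F)) := by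
    intro y
    have : (MulAction.stabilizer (Aut F) y : Set (Aut F)) =
        (MulAction.stabilizer (Aut F) (η.symm y.down) : Set (Aut F)) := by
      ext σ
      simp only [SetLike.mem_coe, MulAction.mem_stabilizer_iff]
      constructor
      · intro h
        have := congrArg (fun z : Y' => η.symm z.down) h
        change η.symm (η (σ • η.symm y.down)) = η.symm y.down at this
        rwa [Equiv.symm_apply_apply] at this
      · intro h
        apply ULift.ext
        change η (σ • η.symm y.down) = y.down
        rw [h, Equiv.apply_symm_apply]
    rw [this]
    exact hY _
  obtain ⟨X, e', he'⟩ := exists_obj_of_aut_action F Y' hY'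
  refine ⟨X, e'.trans (Equiv.ulift.trans η.symm), fun σ x => ?_⟩
  simp only [Equiv.trans_apply, he']
  change η.symm (η (σ • η.symm (e' x).down)) = σ • η.symm (Equiv.ulift (e' x))
  rw [Equiv.symm_apply_apply]
  rfl

/-- The stabiliser argument: if `σ ∈ Aut F` (a basepoint of the Galois category `C`) lies in every
open-kernel homomorphism `Aut F → 𝔖_i` below a given subgroup `U`... packaged: if `U ≤ Ker(Aut F →
𝔖(F X))` whenever `|F X| ≤ i`, then every `σ ∈ U` acts trivially on `F X`.
[cite: Mochizuki2012, IUTchI Rem. 2.5.3(i)(T4) p.53] -/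
theorem smul_eq_of_mem_charSubgroup {C : Type u₁} [Category.{v₁} C] [GaloisCategory C]
    (F : C ⥤ FintypeCat.{v₁}) [FiberFunctor F] {i : ℕ} (U : Subgroup (Aut F))
    (hU : ∀ ρ : Aut F →* Equiv.Perm (Fin i), IsOpen (ρ.ker : Set (Aut F)) → U ≤ ρ.ker)
    (X : C) (hX : Nat.card (F.obj X) ≤ i) (σ : Aut F) (hσ : σ ∈ U) (x : F.obj X) : σ • x = x := by
  let ρ : Aut F →* Equiv.Perm (F.obj X) := MulAction.toPermHom (Aut F) (F.obj X)
  have hρ : IsOpen (ρ.ker : Set (Aut F)) := by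
    have : (ρ.ker : Set (Aut F)) = ⋂ x : F.obj X, (MulAction.stabilizer (Aut F) x : Set (Aut F)) := by
      ext τ
      simp only [SetLike.mem_coe, MonoidHom.mem_ker, Set.mem_iInter, MulAction.mem_stabilizer_iff]
      constructor
      · intro h y
        exact congrFun (congrArg (fun π : Equiv.Perm (F.obj X) => (π : F.obj X → F.obj X)) h) y
      · intro h
        ext y
        exact h y
    rw [this]
    exact isOpen_iInter_of_finite fun x => stabilizer_isOpen (Aut F) x
  have hmem : σ ∈ ρ.ker := IsTopologicallyFinitelyGenerated.le_ker_of_card_le hX U hU ρ hρ hσ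
  rw [MonoidHom.mem_ker] at hmem
  exact congrFun (congrArg (fun π : Equiv.Perm (F.obj X) => (π : F.obj X → F.obj X)) hmem) x

/-- DISCHARGE of `isGaloisCountable_of_isStrictlyCoherent` ([IUTchI] Remark 2.5.3 (i) (T4), repaired
form): a connected, strictly coherent semi-graph of anabelioids with countable underlying semi-graph
is Galois-countable. [cite: Mochizuki2012, IUTchI Rem. 2.5.3(i)(T4) p.53] -/
theorem isGaloisCountable_of_isStrictlyCoherent_holds :
    isGaloisCountable_of_isStrictlyCoherent.{v₁, u₁, u} := by
  intro 𝒢 hconn hsc hcount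
  classical
  refine ⟨hcount, ?_⟩
  obtain ⟨N, hN1, hgenV, hgenE⟩ := hsc.exists_bound
  have hqc : 𝒢.IsQuasiCoherent := hsc.isCoherent.isQuasiCoherent
  -- basepoints and characteristic open subgroups `U_{c,i}` of index `≤ M i`
  let FV : ∀ v, 𝒢.V v ⥤ FintypeCat.{v₁} := fun v => GaloisCategory.getFiberFunctor (𝒢.V v)
  let FE : ∀ e, 𝒢.E e ⥤ FintypeCat.{v₁} := fun e => GaloisCategory.getFiberFunctor (𝒢.E e)
  let M : ℕ → ℕ := fun i => (i !) ^ ((i !) ^ N)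
  have hM : ∀ i, 1 ≤ M i := fun i => Nat.one_le_pow _ _ (Nat.factorial_pos i)
  have hUV : ∀ (i : ℕ) (v : 𝒢.graph.Vertex), ∃ U : Subgroup (Aut (FV v)), U.Normal ∧
      IsOpen (U : Set (Aut (FV v))) ∧ U.index ≠ 0 ∧ U.index ≤ M i ∧
      ∀ ρ : Aut (FV v) →* Equiv.Perm (Fin i), IsOpen (ρ.ker : Set (Aut (FV v))) → U ≤ ρ.ker := by
    intro i v
    obtain ⟨s, hs, hd⟩ := hgenV v (FV v)
    obtain ⟨U, h1, h2, h3, h4, h5⟩ := IsTopologicallyFinitelyGenerated.exists_open_normal_le_ker s hd i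
    refine ⟨U, h1, h2, h3, h4.trans ?_, h5⟩
    exact Nat.pow_le_pow_right (Nat.factorial_pos i) (Nat.pow_le_pow_right (Nat.factorial_pos i) hs)
  have hUE : ∀ (i : ℕ) (e : 𝒢.graph.Edge), ∃ U : Subgroup (Aut (FE e)), U.Normal ∧
      IsOpen (U : Set (Aut (FE e))) ∧ U.index ≠ 0 ∧ U.index ≤ M i ∧
      ∀ ρ : Aut (FE e) →* Equiv.Perm (Fin i), IsOpen (ρ.ker : Set (Aut (FE e))) → U ≤ ρ.ker := by
    intro i e
    obtain ⟨s, hs, hd⟩ := hgenE e (FE e)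
    obtain ⟨U, h1, h2, h3, h4, h5⟩ := IsTopologicallyFinitelyGenerated.exists_open_normal_le_ker s hd i
    refine ⟨U, h1, h2, h3, h4.trans ?_, h5⟩
    exact Nat.pow_le_pow_right (Nat.factorial_pos i) (Nat.pow_le_pow_right (Nat.factorial_pos i) hs)
  choose UV hUVn hUVo hUVi hUVM hUVle using hUV
  choose UE hUEn hUEo hUEi hUEM hUEle using hUE
  rcases isEmpty_or_nonempty 𝒢.graph.Vertex with hV | hV
  · /- vertex-free case: the quotient coverings `Π_e / U_{e,i}` -/
    have hT : ∀ (i : ℕ) (e : 𝒢.graph.Edge), ∃ (T : 𝒢.E e) (ε : (FE e).obj T ≃ Aut (FE e) ⧸ UE i e),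
        ∀ (σ : Aut (FE e)) (x : (FE e).obj T), ε (σ • x) = σ • ε x := by
      intro i e
      haveI : (UE i e).Normal := hUEn i e
      haveI : (UE i e).FiniteIndex := Subgroup.finiteIndex_iff.mpr (hUEi i e)
      haveI : Finite (Aut (FE e) ⧸ UE i e) := Subgroup.finite_quotient_of_finiteIndex
      refine exists_obj_of_aut_action' (FE e) (Aut (FE e) ⧸ UE i e) fun q => ?_
      obtain ⟨g, rfl⟩ := QuotientGroup.mk_surjective q
      have : (MulAction.stabilizer (Aut (FE e)) (g : Aut (FE e) ⧸ UE i e) : Set (Aut (FE e))) =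
          (fun σ => g⁻¹ * σ * g) ⁻¹' (UE i e : Set (Aut (FE e))) := by
        ext σ
        simp only [SetLike.mem_coe, MulAction.mem_stabilizer_iff, Set.mem_preimage,
          MulAction.Quotient.smul_coe, smul_eq_mul, QuotientGroup.eq]
        rw [show (σ * g)⁻¹ * g = (g⁻¹ * σ * g)⁻¹ by group, inv_mem_iff]
      rw [this]
      exact (hUEo i e).preimage ((continuous_const.mul continuous_id).mul continuous_const)
    choose T ε hε using hT
    let A : ℕ → 𝒢.BObj := fun i =>
      { S := fun v => (hV.false v).elim
        T := fun e => T i e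
        ψ := fun b v h => (hV.false v).elim }
    refine ⟨A, fun i v => (hV.false v).elim, fun i e => ?_, fun B => ?_⟩
    · -- non-initial: the fibre `Π_e / U` is inhabited
      intro hinit
      have hem : IsEmpty ((FE e).obj (T i e)) := (initial_iff_fiber_empty (FE e) _).1 ⟨hinit⟩
      exact hem.false ((ε i e).symm ((1 : Aut (FE e)) : Aut (FE e) ⧸ UE i e))
    · obtain ⟨d, -, hdE⟩ := BObj.exists_degree 𝒢 hconn B
      refine ⟨d, fun v => (hV.false v).elim, fun e Q => ?_⟩
      haveI : (UE d e).Normal := hUEn d e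
      haveI : PreGaloisCategory.IsConnected (Q.1 : 𝒢.E e) := Q.2
      obtain ⟨q₀⟩ := nonempty_fiber_of_isConnected (FE e) (Q.1 : 𝒢.E e)
      refine splitsOver_of_stabilizer (FE e) q₀ fun σ hσ x => ?_
      -- `σ` stabilises the image coset, hence lies in the normal subgroup `U_{e,d}`
      have h1 : σ • (FE e).map Q.1.arrow q₀ = (FE e).map Q.1.arrow q₀ := by
        rw [mulAction_naturality, hσ]
      have h2 := congrArg (ε d e) h1
      rw [hε] at h2
      obtain ⟨g, hg⟩ := QuotientGroup.mk_surjective (ε d e ((FE e).map Q.1.arrow q₀))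
      rw [← hg, MulAction.Quotient.smul_coe, smul_eq_mul, QuotientGroup.eq] at h2
      have hσU : σ ∈ UE d e := by
        have := (hUEn d e).conj_mem _ h2 g
        rwa [show g * ((σ * g)⁻¹ * g) * g⁻¹ = σ⁻¹ by group, inv_mem_iff] at this
      exact smul_eq_of_mem_charSubgroup (FE e) (UE d e) (hUEle d e) (B.T e) (hdE e (FE e)).le σ hσU x
  · /- the case with a vertex: approximators and free coverings -/
    -- the characteristic covering collections and their approximators
    have happ : ∀ i : ℕ, ∃ (𝒢' : SemiGraphOfAnabelioids.{v₁, u₁, u}) (φ : Hom 𝒢 𝒢'),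
        φ.IsApproximator ∧ φ.Splits
          ({ FV := FV, fiberV := fun v => inferInstance, FE := FE, fiberE := fun e => inferInstance,
             UV := UV i, UE := UE i, isOpen_UV := hUVo i, isOpen_UE := hUEo i,
             index_UV := hUVM i, index_UE := hUEM i } : CoveringCollection 𝒢 (M i)) :=
      fun i => hqc.exists_approximator (M i) (hM i) _
    choose 𝒢' φ happ hsplit using happ
    -- free coverings of the approximators, pulled back
    have hA' : ∀ i : ℕ, ∃ (A' : (𝒢' i).BObj) (M' : ℕ), 1 ≤ M' ∧
        (∀ (v : (𝒢' i).graph.Vertex) (F : (𝒢' i).V v ⥤ FintypeCat.{v₁}) [FiberFunctor F],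
          (∀ (σ : Aut F) (x : F.obj (A'.S v)), σ • x = x → σ = 1) ∧ Nat.card (F.obj (A'.S v)) = M') ∧
        ∀ (e : (𝒢' i).graph.Edge) (F : (𝒢' i).E e ⥤ FintypeCat.{v₁}) [FiberFunctor F],
          (∀ (σ : Aut F) (x : F.obj (A'.T e)), σ • x = x → σ = 1) ∧ Nat.card (F.obj (A'.T e)) = M' := by
      intro i
      obtain ⟨M', hM'1, hbound⟩ := (happ i).isOfBoundedOrder.exists_bound
      -- every edge of `𝒢'` has an abutting branch (transport along the base isomorphism)
      have habut : ∀ e' : (𝒢' i).graph.Edge, ∃ (b' : (𝒢' i).graph.Branch) (v' : (𝒢' i).graph.Vertex),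
          (𝒢' i).graph.edgeOf b' = e' ∧ (𝒢' i).graph.abuts b' = some v' := by
        intro e'
        haveI := (happ i).isIso_base
        obtain ⟨e, he⟩ : ∃ e, (φ i).base.edgeMap e = e' := by
          refine ⟨(inv (φ i).base).edgeMap e', ?_⟩
          have h := congrArg (fun f : (𝒢' i).graph ⟶ (𝒢' i).graph => f.edgeMap e')
            (IsIso.inv_hom_id (φ i).base)
          rw [SemiGraph.comp_edgeMap, SemiGraph.id_edgeMap] at h
          exact h
        obtain ⟨v₀⟩ := hV
        obtain ⟨b, hb, hsome⟩ := SemiGraph.exists_abuts_of_isConnected hconn.isConnected v₀ e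
        obtain ⟨v, hv⟩ := Option.isSome_iff_exists.mp hsome
        refine ⟨(φ i).base.branchMap b, (φ i).base.vertexMap v, ?_, (φ i).base.abuts_branchMap b v hv⟩
        rw [(φ i).base.edgeOf_branchMap, hb, he]
      obtain ⟨A', h1, h2⟩ := (𝒢' i).exists_free_bObj M' hbound (happ i).isOfBoundedOrder.isOfInjectiveType
        habut
      exact ⟨A', M', hM'1, h1, h2⟩
    choose A' M' hM'1 hA'S hA'T using hA'
    let A : ℕ → 𝒢.BObj := fun i => (φ i).pullbackFunctor.obj (A' i)
    refine ⟨A, fun i v => ?_, fun i e => ?_, fun B => ?_⟩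
    · -- non-initial vertex constituents
      intro hinit
      let P := ((φ i).φV v).pullback
      haveI : FiberFunctor (P ⋙ FV v) := fiberFunctor_comp_of_exact P (FV v)
      have hem : IsEmpty ((FV v).obj ((A i).S v)) := (initial_iff_fiber_empty (FV v) _).1 ⟨hinit⟩
      have hcard := (hA'S i ((φ i).base.vertexMap v) (P ⋙ FV v)).2
      change Nat.card ((FV v).obj ((A i).S v)) = M' i at hcard
      haveI := hem
      rw [Nat.card_of_isEmpty] at hcard
      exact absurd hcard.symm (by have := hM'1 i; omega)
    · -- non-initial edge constituents
      intro hinit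
      let P := ((φ i).φE e ((φ i).base.edgeMap e) rfl).pullback
      haveI : FiberFunctor (P ⋙ FE e) := fiberFunctor_comp_of_exact P (FE e)
      have hem : IsEmpty ((FE e).obj ((A i).T e)) := (initial_iff_fiber_empty (FE e) _).1 ⟨hinit⟩
      have hcard := (hA'T i ((φ i).base.edgeMap e) (P ⋙ FE e)).2
      change Nat.card ((FE e).obj ((A i).T e)) = M' i at hcard
      haveI := hem
      rw [Nat.card_of_isEmpty] at hcard
      exact absurd hcard.symm (by have := hM'1 i; omega)
    · -- splitting of `B` of degree `d` over the components of the constituents of `A d`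
      obtain ⟨d, hdV, hdE⟩ := BObj.exists_degree 𝒢 hconn B
      refine ⟨d, fun v P => ?_, fun e Q => ?_⟩
      · haveI : PreGaloisCategory.IsConnected (P.1 : 𝒢.V v) := P.2
        obtain ⟨p₀⟩ := nonempty_fiber_of_isConnected (FV v) (P.1 : 𝒢.V v)
        refine splitsOver_of_stabilizer (FV v) p₀ fun σ hσ x => ?_
        let Pf := ((φ d).φV v).pullback
        haveI : FiberFunctor (Pf ⋙ FV v) := fiberFunctor_comp_of_exact Pf (FV v)
        have h1 : σ • (FV v).map P.1.arrow p₀ = (FV v).map P.1.arrow p₀ := by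
          rw [mulAction_naturality, hσ]
        have hker : pi1Map Pf (FV v) σ = 1 :=
          pi1Map_eq_one_of_free Pf (FV v) ((A' d).S ((φ d).base.vertexMap v))
            (hA'S d ((φ d).base.vertexMap v) (Pf ⋙ FV v)).1 σ ((FV v).map P.1.arrow p₀) h1
        have hσU : σ ∈ UV d v := (hsplit d).1 v (by rw [MonoidHom.mem_ker]; exact hker)
        exact smul_eq_of_mem_charSubgroup (FV v) (UV d v) (hUVle d v) (B.S v) (hdV v (FV v)).le σ hσU x
      · haveI : PreGaloisCategory.IsConnected (Q.1 : 𝒢.E e) := Q.2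
        obtain ⟨q₀⟩ := nonempty_fiber_of_isConnected (FE e) (Q.1 : 𝒢.E e)
        refine splitsOver_of_stabilizer (FE e) q₀ fun σ hσ x => ?_
        let Pf := ((φ d).φE e ((φ d).base.edgeMap e) rfl).pullback
        haveI : FiberFunctor (Pf ⋙ FE e) := fiberFunctor_comp_of_exact Pf (FE e)
        have h1 : σ • (FE e).map Q.1.arrow q₀ = (FE e).map Q.1.arrow q₀ := by
          rw [mulAction_naturality, hσ]
        have hker : pi1Map Pf (FE e) σ = 1 :=
          pi1Map_eq_one_of_free Pf (FE e) ((A' d).T ((φ d).base.edgeMap e))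
            (hA'T d ((φ d).base.edgeMap e) (Pf ⋙ FE e)).1 σ ((FE e).map Q.1.arrow q₀) h1
        have hσU : σ ∈ UE d e := (hsplit d).2 e (by rw [MonoidHom.mem_ker]; exact hker)
        exact smul_eq_of_mem_charSubgroup (FE e) (UE d e) (hUEle d e) (B.T e) (hdE e (FE e)).le σ hσU x

end SemiGraphOfAnabelioids

end Literature.AnabelianGeometry.SemiGraphs
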